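import Summits.QuantumFields.YangMills.Theorems.ForcedResponseSkewnessRunningCouplingCeilingScaleFreeTransfer
import HarnessLib

/-!
# Crux `RunningCouplingCeiling` (stmt-QuantumFields-24275), reshaped line «pointwise-log-ceiling-r» (local split, F2):
# the registered stub `stub_scaleFreeLocal : ScaleFreeLocalPinnedSigR` is EXACTLY «`MomentBounds6` in the pinned unit»

Support file (`--supports stmt-QuantumFields-24275 --as helper`, lead's WAKE target 1 of ≈02:55Z) by the width prover
`ym-line-frs-p3` (g2) of route `ForcedResponseSkewness` (lead `ym-line-frs-p1`):

* `scaleFreeLocalPinnedSigR_of_momentBounds6` — **if for every compact simple `G`, `r` and unit map `a → 0⁺` carrying the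
  repaired pinning clause (a compactly supported positive-time clause-(i) floor witness) the spine's plane-resolved E0′ ceilings
  `MomentBounds6 G r a` hold IN THAT UNIT, then `ScaleFreeLocalPinnedSigR`** (the statement of the registered stub; Defs append
  p598428) — by `localScaleFree_of_momentBounds6` (p593932) at every radius `ℓ`.
* `scaleFreeLocalPinnedSigR_of_momentBounds6_record` — the same from `MomentBounds6` in a REFERENCE unit `u` (e.g. the record unit of
  `BalabanLadder`) together with the comparability «pinned ⇒ `∃ c > 0, ∀ᶠ β, u β ≤ c · a β`» (the fine side of «floor pins the
  unit»), by `localScaleFree_of_momentBounds6_of_eventually_le` (p598364).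

So the stub is femto/UV-class PROVIDED the E0′ ceilings are available in the crux's (pinned) unit — equivalently in a reference
unit not finer than it.  `MomentBounds6` itself is NOT proved here (spine UV leg).

Honest label: CONDITIONAL reductions inside a conditional rung line (leaf R2a `BalabanLadder.NT`); the stub is not closed by this
file; nothing here bears on the Yang–Mills mass gap, which is NOT proved by any of this.
-/

set_option autoImplicit false

noncomputable section

namespace Summit.QuantumFields.YangMills.Cruxes.RunningCouplingCeiling.Pointwise

open scoped SchwartzMap
open MeasureTheory Filter Topology
open Literature.MathematicalPhysics.QuantumFieldTheory Literature.MathematicalPhysics.QuantumLattice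
open Literature.Probability.LatticeModels
open Summit.QuantumFields.YangMills.Cruxes.OSLegsFromFemtoAndGap.DlrCollarTransfer

/-- **`stub_scaleFreeLocal` is «`MomentBounds6` in the pinned unit»**: if every pinned unit map carries the spine's
plane-resolved E0′ ceilings `MomentBounds6 G r a`, then `ScaleFreeLocalPinnedSigR` holds (`localScaleFree_of_momentBounds6` at
each radius `ℓ`). [folklore] -/
theorem scaleFreeLocalPinnedSigR_of_momentBounds6
    (hMB : ∀ (G : Type) [Group G] [TopologicalSpace G] [IsTopologicalGroup G] [CompactSpace G],
      IsCompactSimpleLieGroup G →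
      letI : MeasurableSpace G := borel G
      haveI : BorelSpace G := ⟨rfl⟩
      ∀ (r : LatticeRep G) (a : ℝ → ℝ), (∀ β, 0 < a β) → Filter.Tendsto a Filter.atTop (nhds 0) →
        (∃ (v₀ : 𝓢(EuclideanSpace ℝ (Fin 4), ℝ)) (ε β₅ Λ₅ : ℝ), HasCompactSupport v₀ ∧
          tsupport v₀ ⊆ {y : EuclideanSpace ℝ (Fin 4) | 0 < y 0} ∧ 0 < ε ∧
          ∀ β : ℝ, β₅ ≤ β → ∀ L : ℕ, Λ₅ ≤ a β * L → ε ≤ Q2 G r β L (a β) (thetaTest 4 v₀) v₀) →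
        MomentBounds6 G r a) :
    ScaleFreeLocalPinnedSigR := by
  intro G _ _ _ _ hG
  letI : MeasurableSpace G := borel G
  haveI : BorelSpace G := ⟨rfl⟩
  intro r a hapos hlim hpin ℓ hℓ
  exact localScaleFree_of_momentBounds6 r hapos hlim (hMB G hG r a hapos hlim hpin) ℓ hℓ

/-- **The same from `MomentBounds6` in a reference unit not finer than the pinned one**: if some unit map `u` carries
`MomentBounds6 G r u` and every PINNED unit map `a` satisfies `∃ c > 0, ∀ᶠ β, u β ≤ c · a β` (the fine side of «floor pins the
unit»: a unit finer than the reference one carries no floor), then `ScaleFreeLocalPinnedSigR` holds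
(`localScaleFree_of_momentBounds6_of_eventually_le`). [folklore] -/
theorem scaleFreeLocalPinnedSigR_of_momentBounds6_record
    (hMB : ∀ (G : Type) [Group G] [TopologicalSpace G] [IsTopologicalGroup G] [CompactSpace G],
      IsCompactSimpleLieGroup G →
      letI : MeasurableSpace G := borel G
      haveI : BorelSpace G := ⟨rfl⟩
      ∀ (r : LatticeRep G) (a : ℝ → ℝ), (∀ β, 0 < a β) → Filter.Tendsto a Filter.atTop (nhds 0) →
        (∃ (v₀ : 𝓢(EuclideanSpace ℝ (Fin 4), ℝ)) (ε β₅ Λ₅ : ℝ), HasCompactSupport v₀ ∧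
          tsupport v₀ ⊆ {y : EuclideanSpace ℝ (Fin 4) | 0 < y 0} ∧ 0 < ε ∧
          ∀ β : ℝ, β₅ ≤ β → ∀ L : ℕ, Λ₅ ≤ a β * L → ε ≤ Q2 G r β L (a β) (thetaTest 4 v₀) v₀) →
        ∃ (u : ℝ → ℝ) (c : ℝ), 0 < c ∧ (∀ᶠ β in Filter.atTop, u β ≤ c * a β) ∧ MomentBounds6 G r u) :
    ScaleFreeLocalPinnedSigR := by
  intro G _ _ _ _ hG
  letI : MeasurableSpace G := borel G
  haveI : BorelSpace G := ⟨rfl⟩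
  intro r a hapos hlim hpin ℓ hℓ
  obtain ⟨u, c, hc, hle, hu⟩ := hMB G hG r a hapos hlim hpin
  exact localScaleFree_of_momentBounds6_of_eventually_le r hc hle hu hapos hlim ℓ hℓ

end Summit.QuantumFields.YangMills.Cruxes.RunningCouplingCeiling.Pointwise

end
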